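import Literature.Analysis.FluidPDE.FluidComputer.GalerkinEnergyBalance

/-!
# The Navier–Stokes scaling symmetry on the lattice: integer dilations of Galerkin solutions

The scaling `u(x,t) ↦ m u(mx, m²t)` (`p ↦ m²p`, same `ν`) maps solutions of the Navier–Stokes
equations to solutions [folklore; e.g. the scaling discussion in every regularity text]. On the torus it
survives exactly for INTEGER `m ≠ 0`, and it survives the Galerkin truncation: if `û(k,t)`, `k ∈ S`,
solves the truncated system on the mode set `S` with viscosity `ν`, pressure multiplier `c` and forcing
`f̂`, then

  `û_m(mk, t) := m · û(k, m²t)`   (and `û_m = 0` off `mℤ³`)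

solves the truncated system on the dilated mode set `mS` with the SAME `ν`, pressure multiplier
`m² c(k, m²t)` and forcing `m³ f̂(k, m²t)` (`isGalerkinSolution_dilate`); its energy and enstrophy are
`E_{mS}(û_m)(t) = m² E_S(û)(m²t)` and `Z_{mS}(û_m)(t) = m⁴ Z_S(û)(m²t)` (`truncEnergy_dilate`,
`truncEnstrophy_dilate`). In physical terms: the same flow in a box tiled `m³` times, run `m²` times
faster with `m` times the velocity — an exact identity of the system both engines step, relating runs of
dilated data on proportionally dilated masks (a resolution/box-size consistency check that costs
nothing to state and that any rescaling analysis of the cell's runs can be held against).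

0 sorry, 0 named facts. HONEST FRAMING (cell pub-fluidc): typed infrastructure for a low prior, high
value-of-information experiment on Tao's machine paradigm; NOT a claim that NS blows up.
-/

noncomputable section

namespace Literature.Analysis.FluidPDE.FluidComputer

open Complex ComplexConjugate Finset
open scoped BigOperators

namespace ShellTransfer

/-- Componentwise divisibility `m ∣ k`. [folklore] -/
def MDvd (m : ℤ) (k : Fin 3 → ℤ) : Prop := ∀ i, m ∣ k i

/-- Componentwise divisibility is decidable (three integer divisibility tests). [folklore] -/
instance (m : ℤ) (k : Fin 3 → ℤ) : Decidable (MDvd m k) :=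
  inferInstanceAs (Decidable (∀ i, m ∣ k i))

/-- `m ∣ -k ↔ m ∣ k`. [folklore] -/
theorem mDvd_neg_iff (m : ℤ) (k : Fin 3 → ℤ) : MDvd m (-k) ↔ MDvd m k := by
  unfold MDvd
  simp only [Pi.neg_apply, dvd_neg]

/-- `m ∣ m•q`. [folklore] -/
theorem mDvd_smul (m : ℤ) (q : Fin 3 → ℤ) : MDvd m (m • q) := fun i => ⟨q i, by simp⟩

/-- `(m•q)/m = q` for `m ≠ 0`. [folklore] -/
theorem smul_div {m : ℤ} (hm : m ≠ 0) (q : Fin 3 → ℤ) : (fun i => (m • q) i / m) = q := by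
  funext i
  simp only [Pi.smul_apply, smul_eq_mul]
  exact Int.mul_ediv_cancel_left (q i) hm

/-- **Integer dilation of a Fourier field**: `û_m(k) = m û(k/m)` if `m ∣ k` componentwise, else `0`
(the field `x ↦ m u(mx)`). It is again real and divergence-free. [folklore] -/
def dilate (m : ℤ) (A : FourierVelocity) : FourierVelocity where
  coeff k j := if MDvd m k then (m : ℂ) * A.coeff (fun i => k i / m) j else 0
  reality k i := by
    by_cases h : MDvd m k
    · have h' : MDvd m (-k) := (mDvd_neg_iff m k).mpr h
      rw [if_pos h', if_pos h]
      have e : (fun l => (-k) l / m) = -(fun l => k l / m) := by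
        funext l
        simp only [Pi.neg_apply]
        exact Int.neg_ediv_of_dvd (h l)
      rw [e, A.reality, map_mul, map_intCast]
    · have h' : ¬MDvd m (-k) := fun h' => h ((mDvd_neg_iff m k).mp h')
      rw [if_neg h', if_neg h, map_zero]
  divFree k := by
    by_cases h : MDvd m k
    · simp only [if_pos h]
      have e : ∀ i, ((k i : ℤ) : ℂ) = (m : ℂ) * (((k i / m : ℤ)) : ℂ) := by
        intro i
        have := Int.mul_ediv_cancel' (h i)
        exact_mod_cast this.symm
      have hq := A.divFree (fun i => k i / m)
      calc ∑ i, ((k i : ℤ) : ℂ) * ((m : ℂ) * A.coeff (fun i => k i / m) i)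
          = (m : ℂ) * (m : ℂ) * ∑ i, (((k i / m : ℤ)) : ℂ) * A.coeff (fun i => k i / m) i := by
            rw [Finset.mul_sum]
            refine Finset.sum_congr rfl fun i _ => ?_
            rw [e i]; ring
        _ = 0 := by rw [hq, mul_zero]
    · simp only [if_neg h, mul_zero, Finset.sum_const_zero]

/-- On the dilated lattice: `û_m(m q) = m û(q)`. [folklore] -/
theorem dilate_coeff_smul {m : ℤ} (hm : m ≠ 0) (A : FourierVelocity) (q : Fin 3 → ℤ) :
    (dilate m A).coeff (m • q) = fun j => (m : ℂ) * A.coeff q j := by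
  funext j
  show (if MDvd m (m • q) then (m : ℂ) * A.coeff (fun i => (m • q) i / m) j else 0) = _
  rw [if_pos (mDvd_smul m q), smul_div hm]

/-- Off the dilated lattice: `û_m(k) = 0`. [folklore] -/
theorem dilate_coeff_of_not {m : ℤ} {k : Fin 3 → ℤ} (h : ¬MDvd m k) (A : FourierVelocity) :
    (dilate m A).coeff k = 0 := by
  funext j
  show (if MDvd m k then (m : ℂ) * A.coeff (fun i => k i / m) j else 0) = 0
  rw [if_neg h]

/-- `|m q|² = m² |q|²`. [folklore] -/
theorem knormSq_smul (m : ℤ) (q : Fin 3 → ℤ) : knormSq (m • q) = (m : ℝ) ^ 2 * knormSq q := by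
  unfold knormSq
  rw [Finset.mul_sum]
  refine Finset.sum_congr rfl fun i _ => ?_
  simp only [Pi.smul_apply, smul_eq_mul, Int.cast_mul]
  ring

/-- `(m q) · a = m (q · a)`. [folklore] -/
theorem kdot_smul_left (m : ℤ) (q : Fin 3 → ℤ) (a : Fin 3 → ℂ) : kdot (m • q) a = (m : ℂ) * kdot q a := by
  unfold kdot
  rw [Finset.mul_sum]
  refine Finset.sum_congr rfl fun i _ => ?_
  simp only [Pi.smul_apply, smul_eq_mul, Int.cast_mul]
  ring

/-- **The truncated advection term scales like `m³`**: `N_{mS}[û_m](m q) = m³ N_S[û](q)`. [folklore] -/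
theorem advection_dilate {m : ℤ} (hm : m ≠ 0) (A : FourierVelocity) (S : Finset (Fin 3 → ℤ))
    (q : Fin 3 → ℤ) (j : Fin 3) :
    advection (dilate m A) (S.image fun p => m • p) (m • q) j = (m : ℂ) ^ 3 * advection A S q j := by
  unfold advection
  have hinj : Set.InjOn (fun p : Fin 3 → ℤ => m • p) S := by
    intro p _ p' _ h
    funext i
    have := congrFun h i
    simp only [Pi.smul_apply, smul_eq_mul] at this
    exact mul_left_cancel₀ hm this
  rw [Finset.sum_image (f := fun p => kdot (m • q) ((dilate m A).coeff (m • q - p)) * (dilate m A).coeff p j) hinj]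
  simp only [Finset.mul_sum]
  refine Finset.sum_congr rfl fun p _ => ?_
  rw [← smul_sub, dilate_coeff_smul hm, dilate_coeff_smul hm, kdot_smul_left]
  have e : kdot q (fun i => (m : ℂ) * A.coeff (q - p) i) = (m : ℂ) * kdot q (A.coeff (q - p)) := by
    unfold kdot
    rw [Finset.mul_sum]
    refine Finset.sum_congr rfl fun i _ => ?_
    ring
  rw [e]
  ring

/-- Modal energy scales like `m²`. [folklore] -/
theorem modalEnergy_dilate {m : ℤ} (hm : m ≠ 0) (A : FourierVelocity) (q : Fin 3 → ℤ) :
    modalEnergy (dilate m A) (m • q) = (m : ℝ) ^ 2 * modalEnergy A q := by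
  unfold modalEnergy
  rw [dilate_coeff_smul hm]
  simp only [Complex.normSq_mul, Complex.normSq_intCast]
  rw [Finset.mul_sum, Finset.mul_sum, Finset.mul_sum]
  refine Finset.sum_congr rfl fun j _ => ?_
  ring

/-- **`E_{mS}(û_m) = m² E_S(û)`**. [folklore] -/
theorem truncEnergy_dilate {m : ℤ} (hm : m ≠ 0) (A : FourierVelocity) (S : Finset (Fin 3 → ℤ)) :
    truncEnergy (dilate m A) (S.image fun p => m • p) = (m : ℝ) ^ 2 * truncEnergy A S := by
  unfold truncEnergy
  have hinj : Set.InjOn (fun p : Fin 3 → ℤ => m • p) S := by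
    intro p _ p' _ h
    funext i
    have := congrFun h i
    simp only [Pi.smul_apply, smul_eq_mul] at this
    exact mul_left_cancel₀ hm this
  rw [Finset.sum_image hinj, Finset.mul_sum]
  exact Finset.sum_congr rfl fun q _ => modalEnergy_dilate hm A q

/-- **`Z_{mS}(û_m) = m⁴ Z_S(û)`**. [folklore] -/
theorem truncEnstrophy_dilate {m : ℤ} (hm : m ≠ 0) (A : FourierVelocity) (S : Finset (Fin 3 → ℤ)) :
    truncEnstrophy (dilate m A) (S.image fun p => m • p) = (m : ℝ) ^ 4 * truncEnstrophy A S := by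
  unfold truncEnstrophy
  have hinj : Set.InjOn (fun p : Fin 3 → ℤ => m • p) S := by
    intro p _ p' _ h
    funext i
    have := congrFun h i
    simp only [Pi.smul_apply, smul_eq_mul] at this
    exact mul_left_cancel₀ hm this
  rw [Finset.sum_image hinj, Finset.mul_sum]
  refine Finset.sum_congr rfl fun q _ => ?_
  rw [knormSq_smul, modalEnergy_dilate hm]
  ring

/-- **NAVIER–STOKES SCALING ON THE LATTICE.** If `U` solves the Galerkin system on `S` (viscosity `ν`,
pressure multiplier `c`, forcing `f`), then `t ↦ dilate m (U (m² t))` solves the Galerkin system on `mS`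
with the same `ν`, pressure multiplier `m² c(m²t, k/m)` and forcing `m³ f(m²t, k/m)` (zero off `mℤ³`),
for every integer `m ≠ 0`. [folklore: `u ↦ m u(mx, m²t)`] -/
theorem isGalerkinSolution_dilate {U : ℝ → FourierVelocity} {S : Finset (Fin 3 → ℤ)} {ν : ℝ}
    {c : ℝ → (Fin 3 → ℤ) → ℂ} {f : ℝ → (Fin 3 → ℤ) → Fin 3 → ℂ} (hU : IsGalerkinSolution U S ν c f)
    {m : ℤ} (hm : m ≠ 0) :
    IsGalerkinSolution (fun t => dilate m (U ((m : ℝ) ^ 2 * t))) (S.image fun p => m • p) ν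
      (fun t k => (m : ℂ) ^ 2 * c ((m : ℝ) ^ 2 * t) (fun i => k i / m))
      (fun t k j => if MDvd m k then (m : ℂ) ^ 3 * f ((m : ℝ) ^ 2 * t) (fun i => k i / m) j else 0) := by
  intro t k hk j
  obtain ⟨q, hq, rfl⟩ := Finset.mem_image.mp hk
  -- the coefficient curve at `m q` is `s ↦ m û(q, m² s)`
  have e : (fun s => (dilate m (U ((m : ℝ) ^ 2 * s))).coeff (m • q) j) =
      fun s => (m : ℂ) * (U ((m : ℝ) ^ 2 * s)).coeff q j := by
    funext s
    rw [dilate_coeff_smul hm]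
  rw [e]
  -- chain rule
  have hin : HasDerivAt (fun s : ℝ => (m : ℝ) ^ 2 * s) ((m : ℝ) ^ 2) t := by
    have h := (hasDerivAt_id t).const_mul ((m : ℝ) ^ 2)
    simp only [id, mul_one] at h
    exact h
  have h1 : HasDerivAt (fun s => (U ((m : ℝ) ^ 2 * s)).coeff q j)
      (((m : ℝ) ^ 2) • galerkinRHS (U ((m : ℝ) ^ 2 * t)) S ν (c ((m : ℝ) ^ 2 * t)) (f ((m : ℝ) ^ 2 * t)) q j) t :=
    HasDerivAt.scomp t (hU ((m : ℝ) ^ 2 * t) q hq j) hin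
  have h2 := h1.const_mul (m : ℂ)
  refine h2.congr_deriv ?_
  -- compare the two right-hand sides
  rw [Complex.real_smul]
  unfold galerkinRHS
  beta_reduce
  rw [advection_dilate hm, knormSq_smul, if_pos (mDvd_smul m q), smul_div hm]
  have ec : (dilate m (U ((m : ℝ) ^ 2 * t))).coeff (m • q) j = (m : ℂ) * (U ((m : ℝ) ^ 2 * t)).coeff q j := by
    rw [dilate_coeff_smul hm]
  rw [ec]
  simp only [Pi.smul_apply, smul_eq_mul, Int.cast_mul]
  push_cast
  ring

/-- Along the dilated solution the energy is `m²` times the energy at the rescaled time. [folklore] -/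
theorem truncEnergy_dilate_sol (U : ℝ → FourierVelocity) (S : Finset (Fin 3 → ℤ)) {m : ℤ} (hm : m ≠ 0)
    (t : ℝ) :
    truncEnergy (dilate m (U ((m : ℝ) ^ 2 * t))) (S.image fun p => m • p) =
      (m : ℝ) ^ 2 * truncEnergy (U ((m : ℝ) ^ 2 * t)) S :=
  truncEnergy_dilate hm _ S

end ShellTransfer

end Literature.Analysis.FluidPDE.FluidComputer

end
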